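import Summits.QuantumFields.YangMills.Theorems.BalabanUVNodesN15KingModelCurvatureFlux
import Summits.QuantumFields.YangMills.Theorems.BalabanUVNodesN15KingModelCovariantDecay
import Literature.MathematicalPhysics.QuantumLattice.TorusTestPotential
import HarnessLib

/-!
# BalabanUVNodes ∕ N15 — THE KING-MODEL RUNG (PART Ϳ-g): COERCIVITY ⟹ EXPONENTIAL DECAY — a covariant Combes–Thomas estimate in QUADRATIC-FORM version for `−cΔ_U+m²` at EVERY
# unitary link field (any fibre): if `Re⟨v,(−cΔ_U+m²)v⟩ ≥ κ‖v‖²` then `‖G_U((x,i),(y,j))‖ ≤ e^{−δ·d(x,y)} ∕ (κ − 2(d+1)c(cosh δ − 1))` for every `δ` with the denominator positive;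
# in particular the MASSLESS covariance at a uniformly curved field (Ϳ-b∕Ϳ-c∕Ϳ-f: `κ = 2c·λ`) DECAYS EXPONENTIALLY, volume-independently — curvature as an infrared regulator
# (Track A, DAG node N15 = NE2; FAN-OUT v1.1 §N15 s3 «KING-MODEL RUNG … + what the curved case adds»; count-neutral)

HONEST FRAMING.  Count-neutral (cell `pub-ymgap`, seat `pub-ymgap-dag-n15-e` g46; `--supports stmt-QuantumFields-27247 --as helper` = K3ᴬ, KEY MAP v3).  King's fine covariance layer
`−cΔ_U+m²` (Ͱ-a `covLapF`) at unitary link fields on ONE finite torus; the standard Combes–Thomas mechanism (the first-order conjugation error of a Laplacian is antisymmetric and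
cancels, leaving `cosh − 1` per bond) typed for the COVARIANT operator; NOT Bałaban's `G_k(U)` (no block term; his regime is the regular one, where `κ` comes from `m²` or from the
averaging penalty — tree `King1986.UniformDecay`, `Beta.CombesThomasForm`, N06's `B9Thm31GpDecayPlaqClosedZd`, none restated); NOT [Balaban1985BackgroundPropagators] (3.42); NOT a node
discharge (N15 of record untouched); nothing continuum ∕ ℝ⁴ ∕ OS ∕ Clay.

THE RESULTS (`K` any period vector, `c ≥ 0`, any `m²`, fibre `𝕜ⁿ`, `U` unitary; `d = tdistT` = the sup-circular torus distance of `King1986.UniformDecay`):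
* §1 ★ `star_dotProduct_covLapF_mulVec` — THE BILINEAR BOND EXPANSION `⟨ω, M_Uη⟩ = DΣ_x⟨ω_x,η_x⟩ − cΣ_{(x,μ)}(⟨ω_x, U(x,μ)η_{x+e_μ}⟩ + ⟨ω_{x+e_μ}, U(x,μ)^*η_x⟩)`, `D = m²+2(d+1)c` (King's
  stencil Ͱ-a `covLapF_mulVec_apply`, backward terms reindexed);
* §2 the weights `expWt φ v (x,i) = e^{φ(x)}v(x,i)` and ★★★ **`re_conjForm_ge`** — THE CONJUGATED FORM IS STILL COERCIVE: if `κ·Σ‖v_x‖² ≤ Re⟨v,M_Uv⟩` for all `v` and `|φ(x) − φ(x+e_μ)| ≤ δ`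
  on every bond, then `Re⟨e^{φ}ω, M_U(e^{−φ}ω)⟩ ≥ (κ − 2(d+1)c(cosh δ − 1))·Σ‖ω_x‖²` — the bond pair `(x,μ)` contributes `2cosh(φ(x)−φ(x+e_μ))·Re⟨ω_x,Uω_{x+e_μ}⟩` instead of `2Re⟨…⟩`
  (`re_weighted_bond_pair`), and `|Re⟨ω_x, Uω_{x+e_μ}⟩| ≤ ‖ω_x‖‖ω_{x+e_μ}‖`;
* §3 ★★★★ **`norm_covLapF_inv_entry_le_exp_of_coercive`** — `κ > 0`, `ρ := 2(d+1)c(cosh δ − 1) < κ` ⟹ `M_U` invertible and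
  `‖(−cΔ_U+m²)⁻¹((x,i),(y,j))‖ ≤ e^{−δ·d(x,y)}∕(κ − ρ)` for ALL sites and fibre indices (weight `φ = δ·d(·,y)`, 1-Lipschitz across bonds by `abs_tdistT_sub_le`∕`tdistT_add_unitVec_le`;
  the column `w = G_Ue_{(y,j)}`, `ω = e^{φ}w`: `(κ−ρ)‖ω‖² ≤ Re⟨e^{φ}ω, e_{(y,j)}⟩ ≤ ‖ω‖`); `exists_rate_of_coercive` (an admissible `δ = min(1, √(κ∕(4(d+1)c+1)))` with `ρ ≤ κ∕2`, via the
  tree's `cosh_sub_one_le_sq_of_abs_le_one`), ★★★ `norm_covLapF_inv_entry_le_exp_half` (`≤ (2∕κ)e^{−δd(x,y)}` at that rate);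
* §4 ★★★★ **`norm_covLapF_fluxLink_massless_inv_entry_le`** — at the constant-flux field (`p_{ν₀} ≠ 0`, `c > 0`, `m² = 0`): `|G_U(x,y)| ≤ (c(2−2cos(p′∕4)))⁻¹·e^{−δ·d(x,y)}` with
  `δ = δ(d, 2−2cos(p′∕4)) > 0` INDEPENDENT OF THE VOLUME AND OF `c` — the massless covariant covariance at non-zero flux decays exponentially in lattice units, whereas at `U ≡ 1` it does
  not exist and at a toron its massless norm is `≍ K²` (Ͷ-e); ★★★ `norm_covLapF_inv_entry_le_exp_of_plaq` (the same from any plaquette bound of Ϳ-b, any fibre).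
WHAT THE CURVED CASE ADDS (as theorems): curvature bounded below not only opens a gap (Ϳ-b…Ϳ-f) but LOCALISES King's covariance exponentially on the scale `δ⁻¹ ≍ λ^{−1∕2}` lattice
units, at zero mass, uniformly in the volume — the infrared role played by `m²` at `U ≡ 1` (Ε-d∕Ͱ-e, rates `κ_m → 0` as `m → 0`) is taken over by the field strength.
PRIOR TREE ART (by name, not restated): Ͱ-a (`covLapF`, `covLapF_mulVec_apply`, `isHermitian_covLapF`), Ͱ-b (`fib`, `norm_apply_le_norm_fib`, `norm_toEuclideanLin_of_mem_unitaryGroup`), Ͱ-d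
(`re_bond_terms`), Ͱ-f (`sum_norm_fib_sq`, `re_star_dotProduct_le_norm_mul_norm`), Ϳ-a (`plaqGap`), Ϳ-b (`re_quadForm_covLapF_ge_plaq`), Ϳ-c (`re_quadForm_covLapF_fluxLink_ge`, `fluxGap_pos`),
`King1986.Torus` (`tdistT`, `tdistT_self`, `tdistT_nonneg`, `abs_tdistT_sub_le`, `tdistT_add_unitVec_le`), `QuantumLattice.cosh_sub_one_le_sq_of_abs_le_one`, Mathlib (`Real.cosh_le_cosh`,
`Real.one_le_cosh`, `Matrix.mulVec_injective_iff_isUnit`).  Dedup (rg at filing): basename 0 files; needles `star_dotProduct_covLapF_mulVec|re_conjForm_ge|norm_covLapF_inv_entry_le_exp_of_coercive|expWt`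
checked.  Locators: Combes–Thomas (1973) mechanism as in the tree's `Beta.CombesThomasForm` header (folklore; no new source); [DodziukMathai2006] §1 Cor 1.3; [Balaban1985BackgroundPropagators]
(3.23) p.394, (3.39)∕(3.42) p.397 (shape of the decay statement only); [King1986] (4.4) p.670, (4.38) p.674 (shape).  0 `sorry`, 1 `def`.
-/

noncomputable section
open scoped BigOperators ComplexConjugate ComplexOrder InnerProductSpace
open Finset Matrix WithLp

namespace Summit.QuantumFields.YangMills.BalabanUVNodes.N15KingModelRung.Curvature

open Literature.MathematicalPhysics.QuantumFieldTheory.Balaban1983to89.B5Prop11Plancherel (Tor unitVec sOf)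
open Literature.MathematicalPhysics.QuantumFieldTheory.King1986.Torus (tdistT tdistT_self tdistT_nonneg abs_tdistT_sub_le tdistT_add_unitVec_le)
open Literature.MathematicalPhysics.QuantumLattice (cosh_sub_one_le_sq_of_abs_le_one)
open Summit.QuantumFields.YangMills.BalabanUVNodes.N15KingModelRung.Covariant
  (covLapF covLapF_mulVec_apply fib fib_apply norm_apply_le_norm_fib norm_toEuclideanLin_of_mem_unitaryGroup re_bond_terms isHermitian_covLapF sum_norm_fib_sq
    sum_norm_fib_add_unitVec re_star_dotProduct_le_norm_mul_norm)
open Summit.QuantumFields.YangMills.BalabanUVNodes.N15KingModelRung.Cover (kingPlaq fluxLink fluxLink_mem_unitaryGroup)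

variable {d : ℕ} (K : Fin (d + 1) → ℕ) [hK : ∀ μ, NeZero (K μ)]
variable {𝕜 : Type*} [RCLike 𝕜] {n : Type*} [Fintype n] [DecidableEq n] {c : ℝ}

/-! ## §1 The bilinear bond expansion of `⟨ω, M_Uη⟩` -/

section Bilinear

/-- ★ **THE BILINEAR BOND EXPANSION**: `⟨ω, M_Uη⟩ = (m²+2(d+1)c)·Σ_x⟨ω_x, η_x⟩ − c·Σ_{x,μ}(⟨ω_x, U(x,μ)η_{x+e_μ}⟩ + ⟨ω_{x+e_μ}, U(x,μ)^*η_x⟩)` (King's stencil with the backward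
terms reindexed `x − e_μ ↦ x`). [cite: King1986, (4.4) p.670; Balaban1985BackgroundPropagators, (3.23) p.394] -/
theorem star_dotProduct_covLapF_mulVec (c m2 : ℝ) (U : Tor K × Fin (d + 1) → Matrix n n 𝕜) (ω η : Tor K × n → 𝕜) :
    star ω ⬝ᵥ (covLapF K c m2 U *ᵥ η)
      = ((m2 + 2 * ((d : ℝ) + 1) * c : ℝ) : 𝕜) * ∑ x, (star (fun i => ω (x, i)) ⬝ᵥ fun i => η (x, i))
        - (c : 𝕜) * ∑ x, ∑ μ, (star (fun i => ω (x, i)) ⬝ᵥ (U (x, μ) *ᵥ fun j => η (x + unitVec K μ, j))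
            + star (fun i => ω (x + unitVec K μ, i)) ⬝ᵥ ((U (x, μ))ᴴ *ᵥ fun j => η (x, j))) := by
  -- pointwise stencil, distributed
  have hpt : ∀ x i, star (ω (x, i)) * (covLapF K c m2 U *ᵥ η) (x, i)
      = ((m2 + 2 * ((d : ℝ) + 1) * c : ℝ) : 𝕜) * (star (ω (x, i)) * η (x, i))
        - (c : 𝕜) * (star (ω (x, i)) * ∑ μ, (U (x, μ) *ᵥ fun j => η (x + unitVec K μ, j)) i)
        - (c : 𝕜) * (star (ω (x, i)) * ∑ μ, ((U (x - unitVec K μ, μ))ᴴ *ᵥ fun j => η (x - unitVec K μ, j)) i) := fun x i => by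
    rw [covLapF_mulVec_apply, Finset.sum_add_distrib]; ring
  -- (a) the diagonal
  have ha : ∑ x, ∑ i, ((m2 + 2 * ((d : ℝ) + 1) * c : ℝ) : 𝕜) * (star (ω (x, i)) * η (x, i))
      = ((m2 + 2 * ((d : ℝ) + 1) * c : ℝ) : 𝕜) * ∑ x, (star (fun i => ω (x, i)) ⬝ᵥ fun i => η (x, i)) := by
    simp only [dotProduct, Pi.star_apply, Finset.mul_sum]
  -- (b) the forward bonds
  have hb : ∑ x, ∑ i, (c : 𝕜) * (star (ω (x, i)) * ∑ μ, (U (x, μ) *ᵥ fun j => η (x + unitVec K μ, j)) i)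
      = (c : 𝕜) * ∑ x, ∑ μ, star (fun i => ω (x, i)) ⬝ᵥ (U (x, μ) *ᵥ fun j => η (x + unitVec K μ, j)) := by
    simp only [dotProduct, Pi.star_apply, Finset.mul_sum]
    exact Finset.sum_congr rfl fun x _ => Finset.sum_comm
  -- (c) the backward bonds, reindexed `x − e_μ ↦ x`
  have hc' : ∑ x, ∑ i, (c : 𝕜) * (star (ω (x, i)) * ∑ μ, ((U (x - unitVec K μ, μ))ᴴ *ᵥ fun j => η (x - unitVec K μ, j)) i)
      = (c : 𝕜) * ∑ x, ∑ μ, star (fun i => ω (x + unitVec K μ, i)) ⬝ᵥ ((U (x, μ))ᴴ *ᵥ fun j => η (x, j)) := by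
    simp only [dotProduct, Pi.star_apply, Finset.mul_sum]
    have hre : ∀ μ : Fin (d + 1), ∑ x, ∑ i, (c : 𝕜) * (star (ω (x, i)) * ((U (x - unitVec K μ, μ))ᴴ *ᵥ fun j => η (x - unitVec K μ, j)) i)
        = ∑ x, ∑ i, (c : 𝕜) * (star (ω (x + unitVec K μ, i)) * ((U (x, μ))ᴴ *ᵥ fun j => η (x, j)) i) := fun μ =>
      (Fintype.sum_equiv (Equiv.addRight (unitVec K μ)) _ _ fun x => by simp only [Equiv.coe_addRight, add_sub_cancel_right]).symm
    calc ∑ x, ∑ i, ∑ μ, (c : 𝕜) * (star (ω (x, i)) * ((U (x - unitVec K μ, μ))ᴴ *ᵥ fun j => η (x - unitVec K μ, j)) i)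
        = ∑ μ, ∑ x, ∑ i, (c : 𝕜) * (star (ω (x, i)) * ((U (x - unitVec K μ, μ))ᴴ *ᵥ fun j => η (x - unitVec K μ, j)) i) := by
          exact (Finset.sum_congr rfl fun x _ => Finset.sum_comm).trans Finset.sum_comm
      _ = ∑ μ, ∑ x, ∑ i, (c : 𝕜) * (star (ω (x + unitVec K μ, i)) * ((U (x, μ))ᴴ *ᵥ fun j => η (x, j)) i) := Finset.sum_congr rfl fun μ _ => hre μ
      _ = ∑ x, ∑ μ, ∑ i, (c : 𝕜) * (star (ω (x + unitVec K μ, i)) * ((U (x, μ))ᴴ *ᵥ fun j => η (x, j)) i) := Finset.sum_comm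
  -- assemble
  calc star ω ⬝ᵥ (covLapF K c m2 U *ᵥ η) = ∑ x, ∑ i, star (ω (x, i)) * (covLapF K c m2 U *ᵥ η) (x, i) := by
        simp only [dotProduct, Pi.star_apply, Fintype.sum_prod_type]
    _ = ∑ x, ∑ i, (((m2 + 2 * ((d : ℝ) + 1) * c : ℝ) : 𝕜) * (star (ω (x, i)) * η (x, i))
          - (c : 𝕜) * (star (ω (x, i)) * ∑ μ, (U (x, μ) *ᵥ fun j => η (x + unitVec K μ, j)) i)
          - (c : 𝕜) * (star (ω (x, i)) * ∑ μ, ((U (x - unitVec K μ, μ))ᴴ *ᵥ fun j => η (x - unitVec K μ, j)) i)) :=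
        Finset.sum_congr rfl fun x _ => Finset.sum_congr rfl fun i _ => hpt x i
    _ = (∑ x, ∑ i, ((m2 + 2 * ((d : ℝ) + 1) * c : ℝ) : 𝕜) * (star (ω (x, i)) * η (x, i)))
          - (∑ x, ∑ i, (c : 𝕜) * (star (ω (x, i)) * ∑ μ, (U (x, μ) *ᵥ fun j => η (x + unitVec K μ, j)) i))
          - ∑ x, ∑ i, (c : 𝕜) * (star (ω (x, i)) * ∑ μ, ((U (x - unitVec K μ, μ))ᴴ *ᵥ fun j => η (x - unitVec K μ, j)) i) := by
        simp only [Finset.sum_sub_distrib]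
    _ = _ := by rw [ha, hb, hc', sub_sub, ← mul_add, ← Finset.sum_add_distrib]; simp only [← Finset.sum_add_distrib]

end Bilinear

/-! ## §2 Exponential weights and the conjugated form -/

section Conj

/-- EXPONENTIALLY WEIGHTED FIELD `(e^{φ}v)(x,i) = e^{φ(x)}v(x,i)` (the weight is real and constant on fibres). [folklore] -/
def expWt (φ : Tor K → ℝ) (v : Tor K × n → 𝕜) : Tor K × n → 𝕜 := fun p => ((Real.exp (φ p.1) : ℝ) : 𝕜) * v p

omit [Fintype n] [DecidableEq n] hK in
/-- `e^{−φ}(e^{φ}v) = v`. [folklore] -/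
theorem wt_neg_wt (φ : Tor K → ℝ) (v : Tor K × n → 𝕜) : expWt K (fun x => -φ x) (expWt K φ v) = v := by
  funext p
  simp only [expWt]
  rw [← mul_assoc, ← RCLike.ofReal_mul, ← Real.exp_add, neg_add_cancel, Real.exp_zero, RCLike.ofReal_one, one_mul]

omit [Fintype n] [DecidableEq n] hK in
/-- `‖(e^{φ}v)(x,i)‖ = e^{φ(x)}‖v(x,i)‖`. [folklore] -/
theorem norm_wt_apply (φ : Tor K → ℝ) (v : Tor K × n → 𝕜) (p : Tor K × n) : ‖expWt K φ v p‖ = Real.exp (φ p.1) * ‖v p‖ := by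
  rw [expWt, norm_mul, RCLike.norm_ofReal, abs_of_pos (Real.exp_pos _)]

omit hK [DecidableEq n] in
/-- Scalar bookkeeping for one bond: `⟨e^{s}a, W(e^{t}b)⟩ = e^{s+t}⟨a, Wb⟩` (real weights). [folklore] -/
theorem star_wt_dotProduct_mulVec_wt (s t : ℝ) (a b : n → 𝕜) (W : Matrix n n 𝕜) :
    star (fun i => ((Real.exp s : ℝ) : 𝕜) * a i) ⬝ᵥ (W *ᵥ fun j => ((Real.exp t : ℝ) : 𝕜) * b j) = ((Real.exp (s + t) : ℝ) : 𝕜) * (star a ⬝ᵥ (W *ᵥ b)) := by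
  have hb : (fun j => ((Real.exp t : ℝ) : 𝕜) * b j) = ((Real.exp t : ℝ) : 𝕜) • b := rfl
  rw [hb, Matrix.mulVec_smul, dotProduct_smul, smul_eq_mul, Real.exp_add, RCLike.ofReal_mul]
  simp only [dotProduct, Pi.star_apply, star_mul', RCLike.star_def, RCLike.conj_ofReal, Finset.mul_sum]
  exact Finset.sum_congr rfl fun i _ => by ring

omit hK [DecidableEq n] in
/-- ★ THE WEIGHTED BOND PAIR: `Re(⟨e^{φ}ω_x, U e^{−φ}ω_{x'}⟩ + ⟨e^{φ}ω_{x'}, U^* e^{−φ}ω_x⟩) = 2cosh(φ(x) − φ(x'))·Re⟨ω_x, Uω_{x'}⟩` — the antisymmetric `sinh` part cancels in the real part.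
[folklore] -/
theorem re_weighted_bond_pair (s t : ℝ) (a b : n → 𝕜) (W : Matrix n n 𝕜) :
    RCLike.re (star (fun i => ((Real.exp s : ℝ) : 𝕜) * a i) ⬝ᵥ (W *ᵥ fun j => ((Real.exp (-t) : ℝ) : 𝕜) * b j)
        + star (fun i => ((Real.exp t : ℝ) : 𝕜) * b i) ⬝ᵥ (Wᴴ *ᵥ fun j => ((Real.exp (-s) : ℝ) : 𝕜) * a j))
      = 2 * Real.cosh (s - t) * RCLike.re (star a ⬝ᵥ (W *ᵥ b)) := by
  rw [star_wt_dotProduct_mulVec_wt, star_wt_dotProduct_mulVec_wt]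
  have hconj : star b ⬝ᵥ (Wᴴ *ᵥ a) = conj (star a ⬝ᵥ (W *ᵥ b)) := by
    rw [dotProduct_mulVec, ← star_mulVec, Matrix.star_dotProduct, RCLike.star_def]
  rw [hconj, map_add, RCLike.re_ofReal_mul, RCLike.re_ofReal_mul, RCLike.conj_re, Real.cosh_eq, show t + -s = -(s - t) by ring, show s + -t = s - t by ring]
  ring

omit hK [DecidableEq n] in
/-- `|Re⟨a, Wb⟩| ≤ ‖a‖‖b‖` for unitary `W` (Cauchy–Schwarz and the isometry). [folklore] -/
theorem abs_re_star_dotProduct_unitary_mulVec_le [DecidableEq n] {W : Matrix n n 𝕜} (hW : W ∈ Matrix.unitaryGroup n 𝕜) (a b : n → 𝕜) :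
    |RCLike.re (star a ⬝ᵥ (W *ᵥ b))| ≤ ‖(toLp 2 a : EuclideanSpace 𝕜 n)‖ * ‖(toLp 2 b : EuclideanSpace 𝕜 n)‖ := by
  have h : star a ⬝ᵥ (W *ᵥ b) = ⟪(toLp 2 a : EuclideanSpace 𝕜 n), Matrix.toEuclideanLin W (toLp 2 b)⟫_𝕜 := by
    rw [Matrix.toLpLin_toLp, Matrix.toLin'_apply, EuclideanSpace.inner_toLp_toLp, dotProduct_comm]
  rw [h, ← norm_toEuclideanLin_of_mem_unitaryGroup hW (toLp 2 b)]
  exact (RCLike.abs_re_le_norm _).trans (norm_inner_le_norm _ _)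

/-- ★★★ **THE CONJUGATED FORM IS STILL COERCIVE**: for unitary `U`, `c ≥ 0`, a form bound `κ·Σ‖v_x‖² ≤ Re⟨v, M_Uv⟩` (all `v`) and a weight with `|φ(x) − φ(x+e_μ)| ≤ δ` on every bond
(any `δ`): `(κ − 2(d+1)c(cosh δ − 1))·Σ_x‖ω_x‖² ≤ Re⟨e^{φ}ω, M_U(e^{−φ}ω)⟩` — each bond contributes `2cosh(Δφ)Re z_b` instead of `2Re z_b`, and `|Re z_b| ≤ ‖ω_x‖‖ω_{x+e_μ}‖`.
[cite: DodziukMathai2006, Cor 1.3 §1; Balaban1985BackgroundPropagators, (3.23) p.394; King1986, (4.4) p.670] -/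
theorem re_conjForm_ge (hc : 0 ≤ c) (m2 : ℝ) {U : Tor K × Fin (d + 1) → Matrix n n 𝕜} (hU : ∀ b, U b ∈ Matrix.unitaryGroup n 𝕜) {κ : ℝ}
    (hcoer : ∀ v : Tor K × n → 𝕜, κ * ∑ x, ‖fib K v x‖ ^ 2 ≤ RCLike.re (star v ⬝ᵥ (covLapF K c m2 U *ᵥ v))) {φ : Tor K → ℝ} {δ : ℝ}
    (hφ : ∀ x μ, |φ x - φ (x + unitVec K μ)| ≤ δ) (ω : Tor K × n → 𝕜) :
    (κ - 2 * ((d : ℝ) + 1) * c * (Real.cosh δ - 1)) * ∑ x, ‖fib K ω x‖ ^ 2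
      ≤ RCLike.re (star (expWt K φ ω) ⬝ᵥ (covLapF K c m2 U *ᵥ expWt K (fun x => -φ x) ω)) := by
  -- the two expansions
  have hE := star_dotProduct_covLapF_mulVec K c m2 U (expWt K φ ω) (expWt K (fun x => -φ x) ω)
  have h0 := star_dotProduct_covLapF_mulVec K c m2 U ω ω
  -- diagonal terms agree
  have hdiag : ∀ x, (star (fun i => expWt K φ ω (x, i)) ⬝ᵥ fun i => expWt K (fun x => -φ x) ω (x, i)) = star (fun i => ω (x, i)) ⬝ᵥ fun i => ω (x, i) := fun x => by
    have h := star_wt_dotProduct_mulVec_wt (𝕜 := 𝕜) (φ x) (-φ x) (fun i => ω (x, i)) (fun i => ω (x, i)) 1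
    simp only [Matrix.one_mulVec, add_neg_cancel, Real.exp_zero, RCLike.ofReal_one, one_mul] at h
    exact h
  -- bond terms: real parts
  have hbond : ∀ x μ, RCLike.re (star (fun i => expWt K φ ω (x, i)) ⬝ᵥ (U (x, μ) *ᵥ fun j => expWt K (fun x => -φ x) ω (x + unitVec K μ, j))
        + star (fun i => expWt K φ ω (x + unitVec K μ, i)) ⬝ᵥ ((U (x, μ))ᴴ *ᵥ fun j => expWt K (fun x => -φ x) ω (x, j)))
      = 2 * Real.cosh (φ x - φ (x + unitVec K μ)) * RCLike.re (star (fun i => ω (x, i)) ⬝ᵥ (U (x, μ) *ᵥ fun j => ω (x + unitVec K μ, j))) := fun x μ =>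
    re_weighted_bond_pair (φ x) (φ (x + unitVec K μ)) (fun i => ω (x, i)) (fun j => ω (x + unitVec K μ, j)) (U (x, μ))
  have hbond0 : ∀ x μ, RCLike.re (star (fun i => ω (x, i)) ⬝ᵥ (U (x, μ) *ᵥ fun j => ω (x + unitVec K μ, j))
        + star (fun i => ω (x + unitVec K μ, i)) ⬝ᵥ ((U (x, μ))ᴴ *ᵥ fun j => ω (x, j)))
      = 2 * RCLike.re (star (fun i => ω (x, i)) ⬝ᵥ (U (x, μ) *ᵥ fun j => ω (x + unitVec K μ, j))) := fun x μ => by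
    have h := re_weighted_bond_pair (𝕜 := 𝕜) 0 0 (fun i => ω (x, i)) (fun j => ω (x + unitVec K μ, j)) (U (x, μ))
    simp only [neg_zero, Real.exp_zero, RCLike.ofReal_one, one_mul, sub_self, Real.cosh_zero, mul_one] at h
    exact h
  -- real parts of the two forms
  set z : Tor K → Fin (d + 1) → ℝ := fun x μ => RCLike.re (star (fun i => ω (x, i)) ⬝ᵥ (U (x, μ) *ᵥ fun j => ω (x + unitVec K μ, j))) with hz
  set N : ℝ := ∑ x, ‖fib K ω x‖ ^ 2 with hN
  have hdiagRe : RCLike.re (∑ x, (star (fun i => ω (x, i)) ⬝ᵥ fun i => ω (x, i))) = N := by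
    rw [map_sum, hN, sum_norm_fib_sq]
    rw [EuclideanSpace.norm_eq, Real.sq_sqrt (Finset.sum_nonneg fun _ _ => sq_nonneg _), Fintype.sum_prod_type]
    refine Finset.sum_congr rfl fun x _ => ?_
    simp only [dotProduct, Pi.star_apply, map_sum, RCLike.star_def]
    refine Finset.sum_congr rfl fun i _ => ?_
    rw [RCLike.conj_mul, ← RCLike.ofReal_pow, RCLike.ofReal_re]
  have hReE : RCLike.re (star (expWt K φ ω) ⬝ᵥ (covLapF K c m2 U *ᵥ expWt K (fun x => -φ x) ω))
      = (m2 + 2 * ((d : ℝ) + 1) * c) * N - c * ∑ x, ∑ μ, 2 * Real.cosh (φ x - φ (x + unitVec K μ)) * z x μ := by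
    rw [hE, map_sub, RCLike.re_ofReal_mul, RCLike.re_ofReal_mul, Finset.sum_congr rfl fun x _ => hdiag x, hdiagRe, map_sum]
    congr 2
    refine Finset.sum_congr rfl fun x _ => ?_
    rw [map_sum]
    exact Finset.sum_congr rfl fun μ _ => hbond x μ
  have hRe0 : RCLike.re (star ω ⬝ᵥ (covLapF K c m2 U *ᵥ ω)) = (m2 + 2 * ((d : ℝ) + 1) * c) * N - c * ∑ x, ∑ μ, 2 * z x μ := by
    rw [h0, map_sub, RCLike.re_ofReal_mul, RCLike.re_ofReal_mul, hdiagRe, map_sum]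
    congr 2
    refine Finset.sum_congr rfl fun x _ => ?_
    rw [map_sum]
    exact Finset.sum_congr rfl fun μ _ => hbond0 x μ
  -- the defect
  have hzle : ∀ x μ, |z x μ| ≤ ‖fib K ω x‖ * ‖fib K ω (x + unitVec K μ)‖ := fun x μ => abs_re_star_dotProduct_unitary_mulVec_le (hU (x, μ)) _ _
  have hcosh : ∀ x μ, Real.cosh (φ x - φ (x + unitVec K μ)) - 1 ≤ Real.cosh δ - 1 := fun x μ => by
    have := Real.cosh_le_cosh.mpr ((hφ x μ).trans (le_abs_self δ))
    linarith
  have hcosh0 : ∀ x μ, 0 ≤ Real.cosh (φ x - φ (x + unitVec K μ)) - 1 := fun x μ => by linarith [Real.one_le_cosh (φ x - φ (x + unitVec K μ))]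
  have hdef : ∑ x, ∑ μ, 2 * Real.cosh (φ x - φ (x + unitVec K μ)) * z x μ - ∑ x, ∑ μ, 2 * z x μ ≤ 2 * ((d : ℝ) + 1) * (Real.cosh δ - 1) * N := by
    rw [← Finset.sum_sub_distrib]
    simp only [← Finset.sum_sub_distrib]
    calc ∑ x, ∑ μ, (2 * Real.cosh (φ x - φ (x + unitVec K μ)) * z x μ - 2 * z x μ)
        ≤ ∑ x, ∑ μ, (Real.cosh δ - 1) * (‖fib K ω x‖ ^ 2 + ‖fib K ω (x + unitVec K μ)‖ ^ 2) := by
          refine Finset.sum_le_sum fun x _ => Finset.sum_le_sum fun μ _ => ?_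
          have h1 : (2 * Real.cosh (φ x - φ (x + unitVec K μ)) * z x μ - 2 * z x μ) = 2 * (Real.cosh (φ x - φ (x + unitVec K μ)) - 1) * z x μ := by ring
          rw [h1]
          have h2 : 2 * (Real.cosh (φ x - φ (x + unitVec K μ)) - 1) * z x μ ≤ 2 * (Real.cosh δ - 1) * |z x μ| := by
            calc 2 * (Real.cosh (φ x - φ (x + unitVec K μ)) - 1) * z x μ ≤ 2 * (Real.cosh (φ x - φ (x + unitVec K μ)) - 1) * |z x μ| :=
                  mul_le_mul_of_nonneg_left (le_abs_self _) (by linarith [hcosh0 x μ])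
              _ ≤ 2 * (Real.cosh δ - 1) * |z x μ| := mul_le_mul_of_nonneg_right (by linarith [hcosh x μ]) (abs_nonneg _)
          have h3 : 2 * |z x μ| ≤ ‖fib K ω x‖ ^ 2 + ‖fib K ω (x + unitVec K μ)‖ ^ 2 := by
            nlinarith [hzle x μ, sq_nonneg (‖fib K ω x‖ - ‖fib K ω (x + unitVec K μ)‖), abs_nonneg (z x μ)]
          have hC0 : 0 ≤ Real.cosh δ - 1 := by linarith [Real.one_le_cosh δ]
          nlinarith
      _ = 2 * ((d : ℝ) + 1) * (Real.cosh δ - 1) * N := by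
          have hsw : ∑ x : Tor K, ∑ μ : Fin (d + 1), ‖fib K ω (x + unitVec K μ)‖ ^ 2 = ((d : ℝ) + 1) * N := by
            rw [Finset.sum_comm]
            simp only [sum_norm_fib_add_unitVec]
            rw [Finset.sum_const, Finset.card_univ, Fintype.card_fin, nsmul_eq_mul, hN]
            push_cast; ring
          have hsx : ∑ x : Tor K, ∑ _μ : Fin (d + 1), ‖fib K ω x‖ ^ 2 = ((d : ℝ) + 1) * N := by
            simp only [Finset.sum_const, Finset.card_univ, Fintype.card_fin, nsmul_eq_mul, hN, Finset.mul_sum]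
            push_cast; ring
          simp only [← Finset.mul_sum, Finset.sum_add_distrib]
          rw [hsw, hsx]; ring
  have hκ := hcoer ω
  rw [hRe0] at hκ
  rw [hReE]
  nlinarith [hdef, hc]

end Conj

/-! ## §3 Coercivity ⟹ exponential decay of `G_U = (−cΔ_U+m²)⁻¹` -/

section Decay

omit [DecidableEq n] in
/-- A coercive form bound makes `M_U` injective, hence invertible. [folklore] -/
theorem isUnit_covLapF_of_coercive [DecidableEq n] (c m2 : ℝ) (U : Tor K × Fin (d + 1) → Matrix n n 𝕜) {κ : ℝ} (hκ : 0 < κ)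
    (hcoer : ∀ v : Tor K × n → 𝕜, κ * ∑ x, ‖fib K v x‖ ^ 2 ≤ RCLike.re (star v ⬝ᵥ (covLapF K c m2 U *ᵥ v))) : IsUnit (covLapF K c m2 U) := by
  refine Matrix.mulVec_injective_iff_isUnit.mp fun v w hvw => ?_
  have h0 : covLapF K c m2 U *ᵥ (v - w) = 0 := by rw [Matrix.mulVec_sub, hvw, sub_self]
  have h := hcoer (v - w)
  rw [h0, dotProduct_zero, map_zero] at h
  have hsum : ∑ x, ‖fib K (v - w) x‖ ^ 2 = 0 := le_antisymm (by nlinarith [Finset.sum_nonneg fun x (_ : x ∈ Finset.univ) => sq_nonneg ‖fib K (v - w) x‖]) (Finset.sum_nonneg fun _ _ => sq_nonneg _)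
  rw [sum_norm_fib_sq, sq_eq_zero_iff, norm_eq_zero] at hsum
  have : v - w = 0 := by simpa using congrArg ofLp hsum
  exact sub_eq_zero.mp this

/-- ★★★★ **COERCIVITY ⟹ EXPONENTIAL DECAY (covariant Combes–Thomas)**: for unitary `U`, `c ≥ 0`, a form bound `κ·Σ‖v_x‖² ≤ Re⟨v,(−cΔ_U+m²)v⟩` with `κ > 0`, and any `δ ≥ 0`
with `ρ := 2(d+1)c(cosh δ − 1) < κ`: `‖(−cΔ_U+m²)⁻¹((x,i),(y,j))‖ ≤ e^{−δ·d(x,y)}∕(κ − ρ)` for all sites and fibre indices, `d` = the torus distance `tdistT` — whatever the SOURCE of `κ`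
(mass, curvature, both); volume-independent. [cite: DodziukMathai2006, Cor 1.3 §1; Balaban1985BackgroundPropagators, (3.39) p.397; King1986, (4.38) p.674] -/
theorem norm_covLapF_inv_entry_le_exp_of_coercive (hc : 0 ≤ c) (m2 : ℝ) {U : Tor K × Fin (d + 1) → Matrix n n 𝕜} (hU : ∀ b, U b ∈ Matrix.unitaryGroup n 𝕜) {κ : ℝ} (hκ : 0 < κ)
    (hcoer : ∀ v : Tor K × n → 𝕜, κ * ∑ x, ‖fib K v x‖ ^ 2 ≤ RCLike.re (star v ⬝ᵥ (covLapF K c m2 U *ᵥ v))) {δ : ℝ} (hδ : 0 ≤ δ)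
    (hρ : 2 * ((d : ℝ) + 1) * c * (Real.cosh δ - 1) < κ) (x y : Tor K) (i j : n) :
    ‖(covLapF K c m2 U)⁻¹ (x, i) (y, j)‖ ≤ Real.exp (-(δ * tdistT K x y)) / (κ - 2 * ((d : ℝ) + 1) * c * (Real.cosh δ - 1)) := by
  set M := covLapF K c m2 U with hM
  set ρ : ℝ := 2 * ((d : ℝ) + 1) * c * (Real.cosh δ - 1) with hρdef
  have hκρ : 0 < κ - ρ := by linarith
  -- the column and its weighted version
  set w : Tor K × n → 𝕜 := fun p => M⁻¹ p (y, j) with hw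
  have hMw : M *ᵥ w = Pi.single (y, j) 1 := by
    have : w = M⁻¹ *ᵥ Pi.single (y, j) 1 := by rw [Matrix.mulVec_single_one]; rfl
    rw [this, Matrix.mulVec_mulVec, Matrix.mul_nonsing_inv _ ((Matrix.isUnit_iff_isUnit_det _).mp (isUnit_covLapF_of_coercive K c m2 U hκ hcoer)), Matrix.one_mulVec]
  set φ : Tor K → ℝ := fun z => δ * tdistT K z y with hφ
  have hφL : ∀ z μ, |φ z - φ (z + unitVec K μ)| ≤ δ := fun z μ => by
    rw [hφ]
    show |δ * tdistT K z y - δ * tdistT K (z + unitVec K μ) y| ≤ δ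
    rw [← mul_sub, abs_mul, abs_of_nonneg hδ]
    calc δ * |tdistT K z y - tdistT K (z + unitVec K μ) y| ≤ δ * tdistT K z (z + unitVec K μ) := mul_le_mul_of_nonneg_left (abs_tdistT_sub_le K _ _ _) hδ
      _ ≤ δ * 1 := mul_le_mul_of_nonneg_left (tdistT_add_unitVec_le K z μ) hδ
      _ = δ := mul_one δ
  set ω := expWt K φ w with hω
  have hwω : w = expWt K (fun z => -φ z) ω := by rw [hω, wt_neg_wt]
  -- the conjugated form evaluated on the column
  have hK := re_conjForm_ge K hc m2 hU hcoer hφL ω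
  rw [← hwω, hMw] at hK
  -- `Re⟨e^{φ}ω, e_{(y,j)}⟩ = Re conj(e^{φ(y)}ω(y,j)) ≤ ‖ω(y,j)‖ ≤ ‖ω‖`
  have hφy : φ y = 0 := by rw [hφ]; show δ * tdistT K y y = 0; rw [tdistT_self, mul_zero]
  have hpair : RCLike.re (star (expWt K φ ω) ⬝ᵥ Pi.single (y, j) (1 : 𝕜)) ≤ ‖ω (y, j)‖ := by
    rw [dotProduct_single_one, Pi.star_apply, expWt, hφy, Real.exp_zero, RCLike.ofReal_one, one_mul]
    exact (RCLike.re_le_norm _).trans (norm_star _).le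
  set Nω : ℝ := ‖(toLp 2 ω : EuclideanSpace 𝕜 (Tor K × n))‖ with hNω
  have hsq : ∑ z, ‖fib K ω z‖ ^ 2 = Nω ^ 2 := sum_norm_fib_sq K ω
  have hfib_le : ∀ z, ‖fib K ω z‖ ≤ Nω := fun z => by
    have h1 : ‖fib K ω z‖ ^ 2 ≤ Nω ^ 2 := by
      rw [← hsq]; exact Finset.single_le_sum (fun z _ => sq_nonneg ‖fib K ω z‖) (Finset.mem_univ z)
    exact abs_le_of_sq_le_sq' h1 (norm_nonneg _) |>.2.trans (le_abs_self _) |> fun h => le_trans h (le_of_eq (abs_of_nonneg (norm_nonneg _)))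
  have hωyj : ‖ω (y, j)‖ ≤ Nω := (norm_apply_le_norm_fib K ω y j).trans (hfib_le y)
  -- `(κ − ρ) Nω² ≤ Nω` ⟹ `Nω ≤ 1/(κ − ρ)`
  have hmain : (κ - ρ) * Nω ^ 2 ≤ Nω := by rw [← hsq]; exact hK.trans (hpair.trans hωyj)
  have hN0 : 0 ≤ Nω := norm_nonneg _
  have hNle : Nω ≤ 1 / (κ - ρ) := by
    rw [le_div_iff₀ hκρ]
    by_cases hz : Nω = 0
    · rw [hz, zero_mul]; exact zero_le_one
    · have hpos : 0 < Nω := lt_of_le_of_ne hN0 (Ne.symm hz)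
      nlinarith
  -- `‖w(x,i)‖ = e^{−φ(x)}‖ω(x,i)‖ ≤ e^{−δ d(x,y)}·Nω`
  have hwxi : ‖w (x, i)‖ = Real.exp (-(δ * tdistT K x y)) * ‖ω (x, i)‖ := by
    rw [hwω, norm_wt_apply]
  calc ‖M⁻¹ (x, i) (y, j)‖ = ‖w (x, i)‖ := rfl
    _ = Real.exp (-(δ * tdistT K x y)) * ‖ω (x, i)‖ := hwxi
    _ ≤ Real.exp (-(δ * tdistT K x y)) * Nω := mul_le_mul_of_nonneg_left ((norm_apply_le_norm_fib K ω x i).trans (hfib_le x)) (Real.exp_nonneg _)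
    _ ≤ Real.exp (-(δ * tdistT K x y)) * (1 / (κ - ρ)) := mul_le_mul_of_nonneg_left hNle (Real.exp_nonneg _)
    _ = Real.exp (-(δ * tdistT K x y)) / (κ - ρ) := by rw [mul_one_div]

/-- An ADMISSIBLE RATE: with `δ := min(1, √(κ∕(4(d+1)c + 1)))` one has `δ > 0` and `2(d+1)c(cosh δ − 1) ≤ κ∕2` (`cosh δ − 1 ≤ δ²` for `|δ| ≤ 1`, the tree's
`cosh_sub_one_le_sq_of_abs_le_one`). [folklore] -/
theorem exists_rate_of_coercive (hc : 0 ≤ c) {κ : ℝ} (hκ : 0 < κ) :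
    ∃ δ : ℝ, 0 < δ ∧ δ ≤ 1 ∧ 2 * ((d : ℝ) + 1) * c * (Real.cosh δ - 1) ≤ κ / 2 := by
  set A : ℝ := 4 * ((d : ℝ) + 1) * c + 1 with hA
  have hA0 : 0 < A := by positivity
  refine ⟨min 1 (Real.sqrt (κ / A)), lt_min one_pos (Real.sqrt_pos.mpr (div_pos hκ hA0)), min_le_left _ _, ?_⟩
  set δ := min 1 (Real.sqrt (κ / A)) with hδ
  have hδ0 : 0 ≤ δ := le_min zero_le_one (Real.sqrt_nonneg _)
  have hδ1 : |δ| ≤ 1 := by rw [abs_of_nonneg hδ0]; exact min_le_left _ _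
  have hcosh : Real.cosh δ - 1 ≤ δ ^ 2 := cosh_sub_one_le_sq_of_abs_le_one hδ1
  have hδsq : δ ^ 2 ≤ κ / A := by
    calc δ ^ 2 ≤ (Real.sqrt (κ / A)) ^ 2 := pow_le_pow_left₀ hδ0 (min_le_right _ _) 2
      _ = κ / A := Real.sq_sqrt (div_nonneg hκ.le hA0.le)
  have h1 : 2 * ((d : ℝ) + 1) * c * (Real.cosh δ - 1) ≤ 2 * ((d : ℝ) + 1) * c * (κ / A) :=
    mul_le_mul_of_nonneg_left (hcosh.trans hδsq) (by positivity)
  have h2 : 2 * ((d : ℝ) + 1) * c * (κ / A) ≤ κ / 2 := by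
    rw [div_eq_mul_inv, div_eq_mul_inv]
    have hinv : 2 * ((d : ℝ) + 1) * c * A⁻¹ ≤ 2⁻¹ := by
      rw [← div_eq_mul_inv, div_le_iff₀ hA0, hA]; nlinarith
    nlinarith [hκ.le]
  exact h1.trans h2

/-- ★★★ At an admissible rate (`ρ ≤ κ∕2`): `‖G_U((x,i),(y,j))‖ ≤ (2∕κ)·e^{−δ·d(x,y)}`. [cite: DodziukMathai2006, Cor 1.3 §1; King1986, (4.38) p.674] -/
theorem norm_covLapF_inv_entry_le_exp_half (hc : 0 ≤ c) (m2 : ℝ) {U : Tor K × Fin (d + 1) → Matrix n n 𝕜} (hU : ∀ b, U b ∈ Matrix.unitaryGroup n 𝕜) {κ : ℝ} (hκ : 0 < κ)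
    (hcoer : ∀ v : Tor K × n → 𝕜, κ * ∑ x, ‖fib K v x‖ ^ 2 ≤ RCLike.re (star v ⬝ᵥ (covLapF K c m2 U *ᵥ v))) {δ : ℝ} (hδ : 0 ≤ δ)
    (hρ : 2 * ((d : ℝ) + 1) * c * (Real.cosh δ - 1) ≤ κ / 2) (x y : Tor K) (i j : n) :
    ‖(covLapF K c m2 U)⁻¹ (x, i) (y, j)‖ ≤ 2 / κ * Real.exp (-(δ * tdistT K x y)) := by
  have h := norm_covLapF_inv_entry_le_exp_of_coercive K hc m2 hU hκ hcoer hδ (by linarith) x y i j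
  have hden : κ / 2 ≤ κ - 2 * ((d : ℝ) + 1) * c * (Real.cosh δ - 1) := by linarith
  calc ‖(covLapF K c m2 U)⁻¹ (x, i) (y, j)‖ ≤ Real.exp (-(δ * tdistT K x y)) / (κ - 2 * ((d : ℝ) + 1) * c * (Real.cosh δ - 1)) := h
    _ ≤ Real.exp (-(δ * tdistT K x y)) / (κ / 2) := div_le_div_of_nonneg_left (Real.exp_nonneg _) (by positivity) hden
    _ = 2 / κ * Real.exp (-(δ * tdistT K x y)) := by rw [div_div_eq_mul_div]; ring

end Decay

/-! ## §4 Curvature-induced decay: the massless covariance at a curved field -/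

section Curved

/-- ★★★ **DECAY FROM A PLAQUETTE BOUND** (any fibre): under Ϳ-b's hypothesis (`ν₀ ≠ ν₁`, `Re⟪u,P_U(x,ν₀,ν₁)u⟫ ≤ γ‖u‖²`) with `κ := m² + 2c·λ(γ) > 0`, for every `δ ≥ 0` with
`2(d+1)c(cosh δ − 1) ≤ κ∕2`: `‖(−cΔ_U+m²)⁻¹((x,i),(y,j))‖ ≤ (2∕κ)e^{−δ·d(x,y)}` — in particular at `m² = 0`. [cite: DodziukMathai2006, Cor 1.3 §1; Balaban1985BackgroundPropagators, (3.39) p.397] -/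
theorem norm_covLapF_inv_entry_le_exp_of_plaq (hc : 0 ≤ c) (m2 : ℝ) {U : Tor K × Fin (d + 1) → Matrix n n 𝕜} (hU : ∀ b, U b ∈ Matrix.unitaryGroup n 𝕜) {ν₀ ν₁ : Fin (d + 1)}
    (hν : ν₀ ≠ ν₁) {γ : ℝ} (hγ : ∀ x, ∀ u : EuclideanSpace 𝕜 n, RCLike.re ⟪u, Matrix.toEuclideanLin (kingPlaq K U x ν₀ ν₁) u⟫_𝕜 ≤ γ * ‖u‖ ^ 2)
    (hκ : 0 < m2 + 2 * c * plaqGap γ) {δ : ℝ} (hδ : 0 ≤ δ) (hρ : 2 * ((d : ℝ) + 1) * c * (Real.cosh δ - 1) ≤ (m2 + 2 * c * plaqGap γ) / 2) (x y : Tor K) (i j : n) :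
    ‖(covLapF K c m2 U)⁻¹ (x, i) (y, j)‖ ≤ 2 / (m2 + 2 * c * plaqGap γ) * Real.exp (-(δ * tdistT K x y)) :=
  norm_covLapF_inv_entry_le_exp_half K hc m2 hU hκ (re_quadForm_covLapF_ge_plaq K hc m2 hU hν hγ) hδ hρ x y i j

/-- ★★★★ **THE MASSLESS COVARIANCE AT NON-ZERO CONSTANT FLUX DECAYS EXPONENTIALLY**: for `U = fluxLink K p ν₁` with `p_{ν₀} ≠ 0`, `ν₀ ≠ ν₁`, `c > 0`, `m² = 0`, there is a rate
`δ > 0` (depending on `d` and on the flux gap `2−2cos(p′_{ν₀}∕4)` only — NOT on the volume, NOT on `c`) with `|G_U(x,y)| ≤ (c(2−2cos(p′_{ν₀}∕4)))⁻¹·e^{−δ·d(x,y)}` for all `x, y`.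
At `U ≡ 1` the massless covariance does not exist; at a toron its norm grows like `K²` (Ͷ-e): curvature localises King's covariance where flat backgrounds cannot.
[cite: DodziukMathai2006, Cor 1.3 §1; tHooft1979Flux, NPB 153 (flux sectors, notion); King1986, (4.4) p.670, (4.38) p.674] -/
theorem norm_covLapF_fluxLink_massless_inv_entry_le (hc : 0 < c) {p : Tor K} {ν₀ ν₁ : Fin (d + 1)} (hν : ν₀ ≠ ν₁) (hp : p ν₀ ≠ 0) :
    ∃ δ : ℝ, 0 < δ ∧ 2 * ((d : ℝ) + 1) * (Real.cosh δ - 1) ≤ (2 - 2 * Real.cos (sOf K p ν₀ / 4)) ∧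
      ∀ x y : Tor K, ‖(covLapF K c 0 (fluxLink K p ν₁))⁻¹ (x, ()) (y, ())‖ ≤ (c * (2 - 2 * Real.cos (sOf K p ν₀ / 4)))⁻¹ * Real.exp (-(δ * tdistT K x y)) := by
  set g : ℝ := 2 - 2 * Real.cos (sOf K p ν₀ / 4) with hg
  have hg0 : 0 < g := fluxGap_pos K hp
  -- a rate depending on `d` and `g` only: take the admissible rate for `c = 1`, `κ = 2g`
  obtain ⟨δ, hδ0, hδ1, hδ⟩ := exists_rate_of_coercive (d := d) (c := 1) zero_le_one (κ := 2 * g) (by positivity)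
  refine ⟨δ, hδ0, by nlinarith, fun x y => ?_⟩
  have hκ : 0 < (0 : ℝ) + 2 * c * g := by positivity
  have hcoer := re_quadForm_covLapF_fluxLink_ge K hc.le 0 p hν
  have hρ : 2 * ((d : ℝ) + 1) * c * (Real.cosh δ - 1) ≤ (0 + 2 * c * g) / 2 := by
    have : 2 * ((d : ℝ) + 1) * (Real.cosh δ - 1) ≤ g := by nlinarith
    nlinarith [hc.le]
  have h := norm_covLapF_inv_entry_le_exp_half K hc.le 0 (fluxLink_mem_unitaryGroup K p ν₁) hκ (fun v => by rw [hg]; exact hcoer v) hδ0.le hρ x y () ()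
  calc ‖(covLapF K c 0 (fluxLink K p ν₁))⁻¹ (x, ()) (y, ())‖ ≤ 2 / (0 + 2 * c * g) * Real.exp (-(δ * tdistT K x y)) := h
    _ = (c * g)⁻¹ * Real.exp (-(δ * tdistT K x y)) := by congr 1; rw [zero_add]; field_simp

end Curved

end Summit.QuantumFields.YangMills.BalabanUVNodes.N15KingModelRung.Curvature

end
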